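import Mathlib
import Summits.ValiantsHypothesis.ValiantsHypothesis.Theorems.LacunarySymmetroidMatrixDescartesProductPlusOneLensCloudTop
import Summits.ValiantsHypothesis.ValiantsHypothesis.Theorems.LacunarySymmetroidMatrixDescartesProductPlusOneLensCloudSymmetric

/-!
# Product-plus-one line — CLOUD CORE in lens currency, V: LEFT COMPATIBILITY at separated rates and the
# LAGGED-COMPANY LAW (a global `≤ 1 sign change` class at ratio `q/p ≳ 3.25`, any number of clouds)

Helper file for `stmt-ValiantsHypothesis-18050` (`MatrixDescartes`), line `product_plus_one`, floor
`stub_oneChangeFloorK3`, open core (CL-F1) (clouds).  Sequel of `…LensCloudEnvelope` (p827068), `…LensCloudSwitch`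
(p827257), `…LensCloudTop` (p827289), `…LensCloudSymmetric` (p827382); same dictionary (p3 g20 NOTE §8): cloud
`(κ, p, r)` (T5: `p, r < 0`), phase `y = κ + p e^{-au} + r e^{bu}`, velocity `y' = -a p e^{-au} + b r e^{bu}`, switch
time `e^{(a+b)u*} = a|p|/(b|r|)`, company phase velocity `Θ' = Σ y_i'/(1+y_i²) = -F₁`; a row is COMPATIBLE at `u`
when `ab(κ - y)(1+y²) + 2 y y'² ≥ 0` (then it cannot create a sign change, `…LensCloudSymmetric`).  Def-free.
Nothing here closes a stub; VP ≠ VNP is not touched.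

## What is proved
* LEFT COMPATIBILITY AT SEPARATED RATES (`strictCompatible_before_switch`): if `2a < b` and
  `a²κ² ≤ b(b - 2a)` (with `κ = cot(πa/(a+b)) ≥ 0` this is a condition on the gap ratio `b/a` alone, met for
  `b/a ≥ 2.25`, i.e. support ratio `q/p = (a+b)/a ≥ 3.25`), then EVERY T5 cloud is STRICTLY compatible at EVERY point
  `u ≤ u*` before its own switch — in phase or not (no sign hypothesis on κ is needed).  Mechanism: before the switch `0 ≤ y' ≤ a·(κ - y)` and the
  quadratic `(b-2a)w² - 2aκw + b` (`w = -y`) has no real root.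
  So at separated rates incompatibility (the only source of extra sign changes) lives exclusively on the DECLINES of rows
  that have already switched.
* THE LAGGED-COMPANY LAW (`strictCompatible_of_lag`, `symVelocity_strictAntiOn_of_lag`,
  `phaseVelocity_zero_subsingleton_of_lag`): at such rates, a pure T5 company whose switch times lie in `[lo, hi]` and
  whose every row keeps phase `≤ π/2` (`y_i ≥ 0`) FROM ITS OWN SWITCH TIME until `hi` (a lag condition: nobody has
  decayed below phase π/2 before the last cloud has switched; nothing is asked before a row's switch) has
  `Θ' = -F₁` vanishing AT MOST ONCE on the whole line — (CL-1′) with constant 1, any number of clouds.  This strictly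
  contains the synchronised-company law of `…LensCloudTop` at these rates.
-/

set_option linter.dupNamespace false

open Real Finset BigOperators

namespace Summit.ValiantsHypothesis.ValiantsHypothesis.Theorems.LacunarySymmetroidMatrixDescartes.ProductPlusOne.LensCloudLagged

variable {ι : Type*} [Fintype ι]

/-- the key quadratic has no real root: `2a < b`, `a²κ² ≤ b(b-2a)` ⇒ `(b-2a)w² - 2aκw + b ≥ 0` for every `w`.
[this file's lemma] -/
theorem key_quadratic_nonneg (a b κ w : ℝ) (h2 : 2 * a < b) (hrate : a ^ 2 * κ ^ 2 ≤ b * (b - 2 * a)) :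
    0 ≤ (b - 2 * a) * w ^ 2 - 2 * a * κ * w + b := by
  have hD : 0 < b - 2 * a := by linarith
  have hsq := sq_nonneg ((b - 2 * a) * w - a * κ)
  have hprod : 0 ≤ (b - 2 * a) * ((b - 2 * a) * w ^ 2 - 2 * a * κ * w + b) := by nlinarith
  by_contra hneg
  have hlt : (b - 2 * a) * w ^ 2 - 2 * a * κ * w + b < 0 := not_le.mp hneg
  have := mul_neg_of_pos_of_neg hD hlt
  linarith

/-- **LEFT COMPATIBILITY AT SEPARATED RATES**: `0 < a`, `2a < b`, `0 ≤ κ`, `a²κ² ≤ b(b-2a)`; a T5 cloud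
(`p < 0`, `r < 0`) at a point `u` before its switch (`b|r|e^{(a+b)u} ≤ a|p|`) is STRICTLY compatible.
[this file's theorem] -/
theorem strictCompatible_before_switch (a b κ p r u : ℝ) (ha : 0 < a) (h2 : 2 * a < b)
    (hrate : a ^ 2 * κ ^ 2 ≤ b * (b - 2 * a)) (hp : p < 0) (hr : r < 0)
    (hu : b * (-r) * exp ((a + b) * u) ≤ a * (-p)) :
    0 < a * b * (-(p * exp (-(a * u))) - r * exp (b * u))
              * (1 + (κ + p * exp (-(a * u)) + r * exp (b * u)) ^ 2)
            + 2 * (κ + p * exp (-(a * u)) + r * exp (b * u))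
              * (-(a * p) * exp (-(a * u)) + b * r * exp (b * u)) ^ 2 := by
  have hb : 0 < b := by linarith
  set P := -(p * exp (-(a * u))) with hP
  set Q := -(r * exp (b * u)) with hQ
  have hPpos : 0 < P := by rw [hP, neg_pos]; exact mul_neg_of_neg_of_pos hp (exp_pos _)
  have hQpos : 0 < Q := by rw [hQ, neg_pos]; exact mul_neg_of_neg_of_pos hr (exp_pos _)
  have hy : κ + p * exp (-(a * u)) + r * exp (b * u) = κ - (P + Q) := by rw [hP, hQ]; ring
  have hs : -(a * p) * exp (-(a * u)) + b * r * exp (b * u) = a * P - b * Q := by rw [hP, hQ]; ring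
  have hdepth : -(p * exp (-(a * u))) - r * exp (b * u) = P + Q := by rw [hP, hQ]; ring
  -- before the switch: `bQ ≤ aP`
  have hbQ : b * Q ≤ a * P := by
    have h1 := mul_le_mul_of_nonneg_right hu (exp_pos (-(a * u))).le
    have e1 : b * (-r) * exp ((a + b) * u) * exp (-(a * u)) = b * Q := by
      rw [mul_assoc, ← Real.exp_add, hQ]; ring_nf
    have e2 : a * (-p) * exp (-(a * u)) = a * P := by rw [hP]; ring
    linarith [h1, e1, e2]
  have hs0 : 0 ≤ a * P - b * Q := by linarith
  have hslt : a * P - b * Q < a * (P + Q) := by nlinarith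
  have hs2 : (a * P - b * Q) ^ 2 < (a * (P + Q)) ^ 2 := by nlinarith
  rw [hy, hs, hdepth]
  have ht : 0 < P + Q := by linarith
  rcases le_or_gt 0 (κ - (P + Q)) with hin | hout
  · -- in phase: first term positive, second nonnegative
    have h1 : 0 < a * b * (P + Q) * (1 + (κ - (P + Q)) ^ 2) := by positivity
    have h2 : 0 ≤ 2 * (κ - (P + Q)) * (a * P - b * Q) ^ 2 := by positivity
    linarith
  · -- out of phase: `w = (P+Q) - κ > 0`
    have hw : 0 < (P + Q) - κ := by linarith
    have key := key_quadratic_nonneg a b κ ((P + Q) - κ) h2 hrate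
    -- `2(κ - t)s² > -2 w a² t²`
    have A : 2 * (κ - (P + Q)) * (a * (P + Q)) ^ 2 < 2 * (κ - (P + Q)) * (a * P - b * Q) ^ 2 := by
      have : 2 * (κ - (P + Q)) < 0 := by linarith
      exact mul_lt_mul_of_neg_left hs2 this
    -- `ab t(1+w²) - 2 w a² t² = a t · key`
    have B : a * b * (P + Q) * (1 + (κ - (P + Q)) ^ 2) + 2 * (κ - (P + Q)) * (a * (P + Q)) ^ 2
        = a * (P + Q) * ((b - 2 * a) * ((P + Q) - κ) ^ 2 - 2 * a * κ * ((P + Q) - κ) + b) := by ring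
    have C : 0 ≤ a * (P + Q) * ((b - 2 * a) * ((P + Q) - κ) ^ 2 - 2 * a * κ * ((P + Q) - κ) + b) :=
      mul_nonneg (mul_nonneg ha.le ht.le) key
    linarith

omit [Fintype ι] in
/-- **Every row of a LAGGED company is strictly compatible on `[lo, hi]`**: separated rates as above; T5 rows;
LAG: on `[lo, hi]` a row that has switched (`a|p_i| ≤ b|r_i|e^{(a+b)u}`) is in phase (`y_i ≥ 0`).
[this file's theorem] -/
theorem strictCompatible_of_lag (a b κ lo hi : ℝ) (p r : ι → ℝ) (ha : 0 < a) (h2 : 2 * a < b)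
    (hrate : a ^ 2 * κ ^ 2 ≤ b * (b - 2 * a)) (hp : ∀ i, p i < 0) (hr : ∀ i, r i < 0)
    (hlag : ∀ u ∈ Set.Icc lo hi, ∀ i, a * (-p i) ≤ b * (-r i) * exp ((a + b) * u) →
      0 ≤ κ + p i * exp (-(a * u)) + r i * exp (b * u))
    {u : ℝ} (hu : u ∈ Set.Icc lo hi) (i : ι) :
    0 < a * b * (-(p i * exp (-(a * u))) - r i * exp (b * u))
              * (1 + (κ + p i * exp (-(a * u)) + r i * exp (b * u)) ^ 2)
            + 2 * (κ + p i * exp (-(a * u)) + r i * exp (b * u))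
              * (-(a * p i) * exp (-(a * u)) + b * r i * exp (b * u)) ^ 2 := by
  rcases le_or_gt (b * (-r i) * exp ((a + b) * u)) (a * (-p i)) with hbefore | hafter
  · exact strictCompatible_before_switch a b κ (p i) (r i) u ha h2 hrate (hp i) (hr i) hbefore
  · have hb : 0 < b := by linarith
    exact LensCloudSymmetric.strictCompatible_of_inPhase a b κ (p i) (r i) u ha hb (hp i) (hr i).le
      (hlag u hu i hafter.le)

/-- **The symmetric velocity `e^{(a-b)u}Θ'` of a lagged company is strictly decreasing on `[lo, hi]`.**
[this file's theorem] -/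
theorem symVelocity_strictAntiOn_of_lag [Nonempty ι] (a b κ lo hi : ℝ) (p r : ι → ℝ) (ha : 0 < a)
    (h2 : 2 * a < b) (hrate : a ^ 2 * κ ^ 2 ≤ b * (b - 2 * a)) (hp : ∀ i, p i < 0)
    (hr : ∀ i, r i < 0)
    (hlag : ∀ u ∈ Set.Icc lo hi, ∀ i, a * (-p i) ≤ b * (-r i) * exp ((a + b) * u) →
      0 ≤ κ + p i * exp (-(a * u)) + r i * exp (b * u)) :
    StrictAntiOn (fun u => ∑ i, exp ((a - b) * u) * ((-(a * p i) * exp (-(a * u)) + b * r i * exp (b * u))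
        / (1 + (κ + p i * exp (-(a * u)) + r i * exp (b * u)) ^ 2))) (Set.Icc lo hi) := by
  obtain ⟨i₀⟩ := ‹Nonempty ι›
  exact LensCloudSymmetric.symVelocity_strictAntiOn a b κ p r (Set.Icc lo hi) (convex_Icc lo hi)
    (fun u hu i => (strictCompatible_of_lag a b κ lo hi p r ha h2 hrate hp hr hlag hu i).le)
    i₀ (fun u hu => strictCompatible_of_lag a b κ lo hi p r ha h2 hrate hp hr hlag hu i₀)

/-- **THE LAGGED-COMPANY LAW**: separated rates (`2a < b`, `a²κ² ≤ b(b-2a)`, `κ ≥ 0`), a pure T5 company with all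
switch times in `[lo, hi]` (`hlo`, `hhi`) satisfying the LAG condition on `[lo, hi]` ⇒ the phase velocity
`Θ' = -F₁` has AT MOST ONE ZERO on the whole line. [this file's theorem] -/
theorem phaseVelocity_zero_subsingleton_of_lag [Nonempty ι] (a b κ lo hi : ℝ) (p r : ι → ℝ) (ha : 0 < a)
    (h2 : 2 * a < b) (hrate : a ^ 2 * κ ^ 2 ≤ b * (b - 2 * a)) (hp : ∀ i, p i < 0)
    (hr : ∀ i, r i < 0)
    (hlo : ∀ i, b * (-r i) * exp ((a + b) * lo) ≤ a * (-p i))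
    (hhi : ∀ i, a * (-p i) ≤ b * (-r i) * exp ((a + b) * hi))
    (hlag : ∀ u ∈ Set.Icc lo hi, ∀ i, a * (-p i) ≤ b * (-r i) * exp ((a + b) * u) →
      0 ≤ κ + p i * exp (-(a * u)) + r i * exp (b * u)) :
    {u : ℝ | ∑ i, (-(a * p i) * exp (-(a * u)) + b * r i * exp (b * u))
        / (1 + (κ + p i * exp (-(a * u)) + r i * exp (b * u)) ^ 2) = 0}.Subsingleton := by
  have hab : 0 < a + b := by linarith
  have hb : 0 < b := by linarith
  -- every zero lies in `[lo, hi]` (localisation, upper currency)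
  have hmem : ∀ u, ∑ i, (-(a * p i) * exp (-(a * u)) + b * r i * exp (b * u))
        / (1 + (κ + p i * exp (-(a * u)) + r i * exp (b * u)) ^ 2) = 0 → u ∈ Set.Icc lo hi := by
    intro u hu0
    rw [LensCloudTop.phaseVelocity_eq_zero_iff_top] at hu0
    refine ⟨?_, ?_⟩
    · by_contra h
      exact absurd hu0 (LensCloudTop.topVelocity_pos_below a b κ lo u p r hab hb hr hlo (lt_of_not_ge h)).ne'
    · by_contra h
      exact absurd hu0 (LensCloudTop.topVelocity_neg_above a b κ hi u p r hab hb hr hhi (lt_of_not_ge h)).ne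
  have hanti := symVelocity_strictAntiOn_of_lag a b κ lo hi p r ha h2 hrate hp hr hlag
  intro u hu v hv
  rw [Set.mem_setOf_eq] at hu hv
  have hu' : ∑ i, exp ((a - b) * u) * ((-(a * p i) * exp (-(a * u)) + b * r i * exp (b * u))
        / (1 + (κ + p i * exp (-(a * u)) + r i * exp (b * u)) ^ 2)) = 0 := by
    rw [LensCloudSymmetric.symVelocity_eq, hu, mul_zero]
  have hv' : ∑ i, exp ((a - b) * v) * ((-(a * p i) * exp (-(a * v)) + b * r i * exp (b * v))
        / (1 + (κ + p i * exp (-(a * v)) + r i * exp (b * v)) ^ 2)) = 0 := by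
    rw [LensCloudSymmetric.symVelocity_eq, hv, mul_zero]
  exact hanti.injOn (hmem u hu) (hmem v hv) (hu'.trans hv'.symm)

end Summit.ValiantsHypothesis.ValiantsHypothesis.Theorems.LacunarySymmetroidMatrixDescartes.ProductPlusOne.LensCloudLagged
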